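/-
Origin: expansion seat `planner-pub-hodgecm-toy2-g7-0`, handover #6 HANDOVER 2026-08-18T13:27:34Z (l.3924) md5 591dd5b2; rewrite Toy2g7.Primitive (packager row: handed in STATUS without a t30 kit row; RUN 30 addendum) (`HOME/pub-hodgecm-toy2-g7/lean/Toy2g7/Cyclo17.lean`, md5 591dd5b2, 184 lines);
landed by the gen-8 packager in gate run 30 as `HodgeCM/Model/Toy/Cyclo17.lean` (import ^import Toy2g7\.Primitive[ \t]*$→import HodgeCM.Model.Toy.Primitive ×1).
-/
/-
Origin: CONSISTENCY seat 2 gen 7 `planner-pub-hodgecm-toy2-g7-0` (unit `pub-hodgecm-toy2-g7`), WIP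
`HOME/pub-hodgecm-toy2-g7/lean/Toy2g7/Cyclo17.lean`; intended target `HodgeCM/Model/Toy/Cyclo17.lean` (new leaf).
-/
import Mathlib
import Summits.HodgeConjecture.HodgeCM.Model.Inhabited
import Summits.HodgeConjecture.HodgeCM.Model.Toy.Primitive

/-!
# `ℚ(ζ₁₇)` has only primitive CM types — the F4 row of the census, unconditionally

* `primitive_of_pow_eq_conjAlgAut` — if every non-trivial `ℚ`-automorphism of the CM field `K` has complex conjugation
  among its powers, then EVERY CM type of `K` is primitive (`Primitive K Φ`): the stabiliser of `Φ` is a subgroup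
  avoiding complex conjugation (`Φ ∘ c = Φ̄ ≠ Φ`), hence trivial;
* `exists_pow_eq_of_card_eq` — in a cyclic group of order `2^(k+1)` the (unique) involution is a power of every
  non-trivial element;
* `cyclo17` = `ℚ(ζ₁₇)`: CM, Galois, degree `16`, cyclic Galois group (`IsCyclotomicExtension.autEquivPow`), so
  `cyclo17_primitive : Primitive cyclo17 Φ` for every `Φ`;
* **`descentFactsB₄_realised_needs_F4_or_gysinDescentB_unconditional`**:
  `∃ U, ModelAxioms ∧ RealisationExistsFace ∧ N1 ∧ N2 ∧ N3 ∧ N4 ∧ F5 ∧ D ∧ F-H0 ∧ ¬(F4 ∧ F7d-B) ∧ ¬HC_CM` —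
  given `hR` and the other seven binders of `COR_CM_of_descentFactsB₄`, the pair `{F4, F7d-B}` cannot both be dropped.

All proofs kernel-checked; nothing is cited.
-/

noncomputable section

namespace HodgeCM.Toy

open Literature.AlgebraicGeometry.Motives Module NumberField

/-! ### CM fields all of whose non-trivial automorphisms power to complex conjugation -/

section General

variable (K : CMField)

/-- complex conjugation of a CM field as a `ℚ`-automorphism -/
def conjAlgAut : K ≃ₐ[ℚ] K := (IsCMField.complexConj K).restrictScalars ℚ

/-- (Ported verbatim from the HodgeCMPerL package; no docstring in the source.) -/
theorem conjAlgAut_apply (x : K) : conjAlgAut K x = IsCMField.complexConj K x := rfl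

/-- (Ported verbatim from the HodgeCMPerL package; no docstring in the source.) -/
theorem comp_conjAlgAut (φ : K →+* ℂ) : φ.comp (conjAlgAut K : K →+* K) = ComplexEmbedding.conjugate φ :=
  RingHom.ext fun x => by
    show φ (conjAlgAut K x) = ComplexEmbedding.conjugate φ x
    rw [conjAlgAut_apply, IsCMField.complexEmbedding_complexConj, ComplexEmbedding.conjugate_coe_eq]

/-- (Ported verbatim from the HodgeCMPerL package; no docstring in the source.) -/
theorem conjAlgAut_ne_one : conjAlgAut K ≠ 1 := fun h =>
  IsCMField.complexConj_ne_one K (AlgEquiv.ext fun x => by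
    rw [← conjAlgAut_apply, h]; rfl)

/-- (Ported verbatim from the HodgeCMPerL package; no docstring in the source.) -/
theorem conjAlgAut_sq : conjAlgAut K ^ 2 = 1 :=
  AlgEquiv.ext fun x => by
    rw [sq, AlgEquiv.mul_apply, conjAlgAut_apply, conjAlgAut_apply, IsCMField.complexConj_apply_apply]; rfl

/-- (Ported verbatim from the HodgeCMPerL package; no docstring in the source.) -/
theorem orderOf_conjAlgAut : orderOf (conjAlgAut K) = 2 := orderOf_eq_prime (conjAlgAut_sq K) (conjAlgAut_ne_one K)

variable {K}

/-- the stabiliser condition of `Primitive` is inherited by powers -/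
theorem stab_pow {Φ : CMType K} {φ₀ : K →+* ℂ} {d : K ≃ₐ[ℚ] K}
    (hd : ∀ g : K ≃ₐ[ℚ] K, φ₀.comp ((g * d : K ≃ₐ[ℚ] K) : K →+* K) ∈ Φ.1 ↔ φ₀.comp (g : K →+* K) ∈ Φ.1) (n : ℕ) :
    ∀ g : K ≃ₐ[ℚ] K, φ₀.comp ((g * d ^ n : K ≃ₐ[ℚ] K) : K →+* K) ∈ Φ.1 ↔ φ₀.comp (g : K →+* K) ∈ Φ.1 := by
  induction n with
  | zero => intro g; rw [pow_zero, mul_one]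
  | succ n ih => intro g; rw [pow_succ, ← mul_assoc, hd, ih]

variable (K)

/-- **If every non-trivial automorphism powers to complex conjugation, every CM type is primitive.** -/
theorem primitive_of_pow_eq_conjAlgAut (h : ∀ d : K ≃ₐ[ℚ] K, d ≠ 1 → ∃ n, d ^ n = conjAlgAut K) (Φ : CMType K) :
    Primitive K Φ := by
  intro φ₀ d hd
  by_contra hne
  obtain ⟨n, hn⟩ := h d hne
  have key := stab_pow hd n 1
  rw [one_mul, hn, comp_conjAlgAut] at key
  have h1 : φ₀.comp ((1 : K ≃ₐ[ℚ] K) : K →+* K) = φ₀ := RingHom.ext fun _ => rfl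
  rw [h1] at key
  by_cases hφ : φ₀ ∈ Φ.1
  · exact (Φ.2 φ₀).mp hφ (key.mpr hφ)
  · exact hφ (key.mp (not_not.mp fun hc => hφ ((Φ.2 φ₀).mpr hc)))

end General

/-! ### Cyclic 2-groups: the involution is a power of every non-trivial element -/

/-- (Ported verbatim from the HodgeCMPerL package; no docstring in the source.) -/
theorem exists_pow_eq_of_card_eq {G : Type*} [Group G] [Fintype G] [IsCyclic G] {k : ℕ}
    (hG : Fintype.card G = 2 ^ (k + 1)) {ι : G} (hι : orderOf ι = 2) {d : G} (hd : d ≠ 1) : ∃ n, d ^ n = ι := by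
  classical
  have hm : orderOf d ∣ 2 ^ (k + 1) := hG ▸ orderOf_dvd_card
  obtain ⟨j, -, hmj⟩ := (Nat.dvd_prime_pow Nat.prime_two).1 hm
  have hj0 : j ≠ 0 := by
    rintro rfl
    rw [pow_zero] at hmj
    exact hd (orderOf_eq_one_iff.mp hmj)
  have h2m : 2 ∣ orderOf d := by rw [hmj]; exact dvd_pow_self 2 hj0
  have hm0 : orderOf d ≠ 0 := (orderOf_pos d).ne'
  have hq0 : orderOf d / 2 ≠ 0 := (Nat.div_pos (Nat.le_of_dvd (Nat.pos_of_ne_zero hm0) h2m) two_pos).ne'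
  have hord : orderOf (d ^ (orderOf d / 2)) = 2 := by
    rw [orderOf_pow_of_dvd hq0 (Nat.div_dvd_of_dvd h2m), Nat.div_div_self h2m hm0]
  have hcard := IsCyclic.card_orderOf_eq_totient (α := G) (d := 2)
    (by rw [hG]; exact dvd_pow_self 2 (Nat.succ_ne_zero k))
  rw [Nat.totient_two, Finset.card_eq_one] at hcard
  obtain ⟨a, ha⟩ := hcard
  have h1 : d ^ (orderOf d / 2) ∈ ({a} : Finset G) := by rw [← ha]; simpa using hord
  have h2 : ι ∈ ({a} : Finset G) := by rw [← ha]; simpa using hι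
  exact ⟨orderOf d / 2, by rw [Finset.mem_singleton.mp h1, Finset.mem_singleton.mp h2]⟩

/-! ### The seventeenth cyclotomic field -/

set_option backward.isDefEq.respectTransparency false in
/-- (Ported verbatim from the HodgeCMPerL package; no docstring in the source.) -/
instance cyclotomicField17_isCMField : IsCMField (CyclotomicField 17 ℚ) :=
  IsCyclotomicExtension.Rat.isCMField (CyclotomicField 17 ℚ) (S := ({17} : Set ℕ))
    ⟨17, Set.mem_singleton 17, by norm_num⟩

/-- `ℚ(ζ₁₇)` as a bundled CM field. -/
def cyclo17 : CMField := ⟨CyclotomicField 17 ℚ⟩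

set_option backward.isDefEq.respectTransparency false in
/-- (Ported verbatim from the HodgeCMPerL package; no docstring in the source.) -/
theorem cyclo17_isGalois : IsGalois ℚ cyclo17 :=
  IsCyclotomicExtension.isGalois {17} ℚ (CyclotomicField 17 ℚ)

set_option backward.isDefEq.respectTransparency false in
/-- (Ported verbatim from the HodgeCMPerL package; no docstring in the source.) -/
theorem cyclo17_finrank : finrank ℚ cyclo17 = 16 := by
  have h := IsCyclotomicExtension.finrank (n := 17) (K := ℚ) (CyclotomicField 17 ℚ)
    (Polynomial.cyclotomic.irreducible_rat (by norm_num))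
  rw [Nat.totient_prime (by norm_num : Nat.Prime 17)] at h
  exact h

/-- (Ported verbatim from the HodgeCMPerL package; no docstring in the source.) -/
instance fact_prime_17 : Fact (Nat.Prime 17) := ⟨by norm_num⟩

set_option backward.isDefEq.respectTransparency false in
/-- (Ported verbatim from the HodgeCMPerL package; no docstring in the source.) -/
theorem cyclo17_isCyclic : IsCyclic (cyclo17 ≃ₐ[ℚ] cyclo17) :=
  isCyclic_of_surjective
    (IsCyclotomicExtension.autEquivPow (n := 17) (K := ℚ) (CyclotomicField 17 ℚ)
      (Polynomial.cyclotomic.irreducible_rat (by norm_num))).symm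
    (MulEquiv.surjective _)

/-- (Ported verbatim from the HodgeCMPerL package; no docstring in the source.) -/
theorem cyclo17_card_aut : Fintype.card (cyclo17 ≃ₐ[ℚ] cyclo17) = 2 ^ (3 + 1) := by
  haveI := cyclo17_isGalois
  have h := IsGalois.card_aut_eq_finrank ℚ cyclo17
  rw [Nat.card_eq_fintype_card, cyclo17_finrank] at h
  rw [h]; norm_num

/-- **every CM type of `ℚ(ζ₁₇)` is primitive** -/
theorem cyclo17_primitive (Φ : CMType cyclo17) : Primitive cyclo17 Φ :=
  haveI := cyclo17_isCyclic
  primitive_of_pow_eq_conjAlgAut cyclo17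
    (fun _ hd => exists_pow_eq_of_card_eq cyclo17_card_aut (orderOf_conjAlgAut cyclo17) hd) Φ

end HodgeCM.Toy

namespace HodgeCM.ToyG2

open HodgeCM.Toy
open Literature.AlgebraicGeometry.Motives

/-- **F4 row of the load-bearing census of `COR_CM_of_descentFactsB₄`, UNCONDITIONAL.**
There is a universe (the pullback-family modifier of the exterior toy universe built on a CM type of `ℚ(ζ₁₇)`)
satisfying the 28 model axioms, `RealisationExistsFace`, N1, N2, N3, N4, F5, D and F-H0 in which the Hodge conjecture
for CM products fails and `F4 ∧ F7d-B` fails: given `hR` and the other seven binders, `{F4, F7d-B}` cannot both be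
dropped from `COR_CM_of_descentFactsB₄`. -/
theorem descentFactsB₄_realised_needs_F4_or_gysinDescentB_unconditional :
    ∃ U : Universe, U.ModelAxioms ∧ U.RealisationExistsFace ∧ U.Fact_cupExterior ∧ U.Fact_cup_hodge ∧
      U.Fact_pull_H0 ∧ U.Fact_hodge_F0 ∧ U.Fact_cupAssoc ∧ U.Fact_dimProd ∧ U.Fact_unitH0 ∧
      ¬ (U.Fact_cupAlg ∧ U.Fact_gysinDescentB) ∧ ¬ U.HC_CM :=
  descentFactsB₄_realised_needs_F4_or_gysinDescentB_of_primitive'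
    ⟨cyclo17, HodgeCM.stdCMType cyclo17, cyclo17_isGalois, by rw [cyclo17_finrank]; norm_num, cyclo17_primitive _⟩

/-- Corollary in census form: relative to `ModelAxioms ∧ RealisationExistsFace ∧ N1 ∧ N2 ∧ N3 ∧ N4 ∧ F5 ∧ D ∧ F-H0`,
the conjunction `F4 ∧ F7d-B` is NOT derivable (else `HC_CM` would follow by `COR_CM_of_descentFactsB₄`). -/
theorem not_F4_and_gysinDescentB_of_others :
    ¬ ∀ U : Universe, U.ModelAxioms → U.RealisationExistsFace → U.Fact_cupExterior → U.Fact_cup_hodge →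
      U.Fact_pull_H0 → U.Fact_hodge_F0 → U.Fact_cupAssoc → U.Fact_dimProd → U.Fact_unitH0 →
      (U.Fact_cupAlg ∧ U.Fact_gysinDescentB) := by
  intro h
  obtain ⟨U, M, hR, hN1, hN2, hN3, hN4, h5, hd, hu, hno, -⟩ :=
    descentFactsB₄_realised_needs_F4_or_gysinDescentB_unconditional
  exact hno (h U M hR hN1 hN2 hN3 hN4 h5 hd hu)

end HodgeCM.ToyG2

end
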